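import Summits.BirchSwinnertonDyer.Rank1Residual.X11b.KolyvaginShaOrderOfLeafInputs
import Summits.BirchSwinnertonDyer.Rank1Residual.X11b.Three.KolyvaginShaExponentThree
import Summits.BirchSwinnertonDyer.Rank1Residual.X11b.Three.KolyvaginHexcIdle
import Summits.BirchSwinnertonDyer.Rank1Residual.Additive.X4RankZeroLowerKolyvaginIndexForm
import HarnessLib

/-!
# Kolyvagin's bound `ord_3 #Ш(E/K)[3^∞] ≤ 2 ord_3 [E(K) : ℤ y_K]` on `3 ‖ N_E` and on the class
# X11b @ 3 ∩ (KN₃)/ℚ, from the cite-only leaf inputs at `3` and the Cassels–Tate inputs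
# (cell `b2b-bsdres`, team x11b3 = N8/O2; x11b3-p2 GEN 41, (P2-ORDER-UB) (O-d″) part 4)

HONEST FRAMING (cell `b2b-bsdres`, run/shared/lean/b2b/bsd-rank1-residual/, verbatim in every
file): the goal of the cell is to DELETE the COMBINATION-SHAPED residual classes of the
Birch–Swinnerton-Dyer formula for ALL analytic-rank `≤ 1` elliptic curves over `ℚ` — "full BSD
formula for every rank `≤ 1` curve in class `C`" assembled STRICTLY from published theorems — so
that the rank-`≤ 1` remainder becomes exactly the CONSTRUCTION-SHAPED classes, which are TYPED
(missing-input `Prop`s), NOT attempted. This is not "finishing BSD". The X11b @ 3 class stays OPEN.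
THEOREMS ONLY (no `def`, no `sorry`, no new fact); cite-only labels are NOT facts; nothing
discharged; nothing booked; no mark / label / count / tier moves.

The ORDER-form companion at `p = 3` of `Three/KolyvaginShaAnnihilatorThree` and
`Three/KolyvaginShaExponentThree`: McCallum 1991 §1 Theorem (Kolyvagin)
**`ord_p #Ш(E/K) ≤ 2 ord_p [E(K) : ℤ y_K]`** at `p = 3` for the `3`-primary part — the `hB` binder
(`Kolyvagin1990_padicValNat_card_sha_le`) of `bsdp_of_classX11b_three_of_onTreeInputs` at the prime
`3` — as a kernel theorem MODULO the displayed inputs: the cite-only labels at `3` (SIX with `hGZ`,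
or FIVE on (KN₃)/ℚ) + `hN`, and the Cassels–Tate inputs at level `3^{M₀}` (the tree's own open
inputs of `exists_casselsTate_pairing_of_inputs`: Weil pairing `e` alternating and non-degenerate,
`inv` with `SumInvLocalizationEqZero` and injective at finite places, `hH3`, Milne I 6.13(a)
`IsLevelPairing`, `Gal(K/ℚ)`-equivariance `hPτ`). NOT the named fact; nothing discharged.
Theorems: `card_sha_three_primary_le_of_leafInputs_of_poitouTate_of_localDuality` (`hmult`, SIX
labels, `ρ̄_{E,3}` onto, divisibility form `3^{M₀} x₀ = y_K ∉ 3^{M₀+1}E(K)`, `M₀ ≥ 1`),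
`…_of_classX11b_of_kodairaNeron_rat_of_localDuality'` (FIVE labels on ClassX11b ∩ (KN₃)/ℚ, NO
image hypothesis), `…_of_classX11b_of_kodairaNeron_rat_index_of_localDuality` (the printed
Heegner-INDEX form via McCallum Lemma 5.1 = tree `Additive.zsmul_certificate_of_padicValNat_index`;
any `M₀ = ord_3 [E(K) : ℤ y_K] ≥ 0`, the case `M₀ = 0` being the tree's `…_rat_of_not_dvd`).
Namespace `Summit.BirchSwinnertonDyer.Rank1Residual.X11b.Three.KolyvaginOrder`; `K : Type`.

References: [McCallumLMS1991] §1 Theorem p. 296, Lemma 5.1 p. 303, Prop. 2.2, Prop. 4.7, Lemma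
5.3, Thm. 5.4, Cor. 5.6; [GrossLMS1991] Thm. 1.3 (2), Prop. 2.1 (2), Thm. 2.2 (2), §§3–10;
[MilneADT2006] I §6 Prop. 6.9, Thm. 6.13(a); [SilvermanATAEC1994] II.6.4; [SilvermanAEC2009]
VII.6.1; [Serre1972] §2.4 Prop. 15.
-/

noncomputable section

namespace Summit.BirchSwinnertonDyer.Rank1Residual.X11b.Three.KolyvaginOrder

open scoped Classical
open WeierstrassCurve Field NumberField IsDedekindDomain Function
open Literature.NumberTheory.EllipticCurves Literature.NumberTheory.GaloisRepresentations
open Literature.NumberTheory.EllipticCurves.Rank1Residual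
open Literature.NumberTheory.EllipticCurves.RingClassField
open Literature.NumberTheory.EllipticCurves.ModularForms
open Literature.NumberTheory.DiophantineGeometry Literature.NumberTheory.DiophantineGeometry.TateAlgorithm
open Literature.NumberTheory.GaloisCohomology
open Literature.NumberTheory.GaloisRepresentations.DiscreteGaloisModule (mu MuCarrier)

-- `LocallyCompactSpace Γ_K` / `CharZero` of completions, as in the tree's Cassels–Tate files.
attribute [local instance] absoluteGaloisGroup_compactSpace charZero_placeCompletion

variable {K : Type} [Field K] [NumberField K] {N : ℕ} {W : WeierstrassCurve ℚ}

/-- **`ord_3 #Ш(E/K)[3^∞] ≤ 2M₀` on `3 ‖ N_E` from SIX cite-only inputs AT `3` and the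
Cassels–Tate inputs**, for `3^{M₀} x₀ = y_K ∉ 3^{M₀+1}E(K)`, `M₀ ≥ 1`, `ρ̄_{E,3}` onto:
`KolyvaginOrder.card_sha_primary_le_at_of_leafInputs_of_poitouTate_of_localDuality` at `p = 3` with
`¬ CM` (from `hmult`) and `d_K ∉ {−3, −4}` (from `3 ∣ N_E` and the Heegner hypothesis) SUPPLIED,
binders of `Three.KolyvaginAnnihilator.pow_smul_sha_three_primary_eq_zero_of_leafInputs_of_poitouTate`
VERBATIM; CONDITIONAL on EXACTLY {`hPT`, `hrec`, `hCM`, `h53`, `hGZ`, `hγ`} at `3` + `hN` + `hmult`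
+ the Cassels–Tate inputs. [cite: McCallumLMS1991, §1 Theorem (Kolyvagin), Lemma 5.1, Thm. 5.4, Cor. 5.6]
[cite: GrossLMS1991, Thm. 2.2 (2), §§3–8, §10] [cite: SilvermanATAEC1994, Thm. II.6.4] -/
theorem card_sha_three_primary_le_of_leafInputs_of_poitouTate_of_localDuality [NeZero N]
    [W.IsGloballyMinimal]
    (hPT : Literature.NumberTheory.GaloisCohomology.poitouTate_sum_localTatePairing_eq_zero K)
    (hN : ∀ [W.IsElliptic], N = W.conductorNorm ℤ)
    (hmult : W.HasMultiplicativeReductionAtPrime 3)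
    (hrec : heegnerPointOfConductor_one_galoisConj N W K)
    (hCM : ∀ [W.IsElliptic] (_hK : IsImaginaryQuadratic K) (_hH : SatisfiesHeegnerHypothesis N K)
      (Dt : ModularParametrizationData W N) (β : ℤ) (ι : K →+* ℂ),
      (4 * N : ℤ) ∣ β ^ 2 - NumberField.discr K →
      ∀ {M : ℕ}, 1 ≤ M → ∀ (m : ℕ), Squarefree m →
      (∀ q ∈ m.primeFactors, IsKolyvaginPrime N W K 3 q ∧ FrobEqFrobInfty W K (3 ^ M) q) →
      ∃ y : (W.baseChange (ringClassField K ι m)).toAffine.Point,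
        WeierstrassCurve.Affine.Point.map (W' := W) (ringClassField K ι m).subtype.toRatAlgHom y =
          heegnerPointComplexOfConductor Dt (NumberField.discr K) β m)
    (h53 : ∀ [W.IsElliptic] (_hK : IsImaginaryQuadratic K) (_hH : SatisfiesHeegnerHypothesis N K)
      (Dt : ModularParametrizationData W N) (β : ℤ) (ι : K →+* ℂ) {M : ℕ}
      (_hM : 1 ≤ M) {n : ℕ} (_hn : Squarefree n)
      (_hKol : ∀ q ∈ n.primeFactors, IsKolyvaginPrime N W K 3 q ∧ FrobEqFrobInfty W K (3 ^ M) q)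
      (d : (m : ℕ) → m ∣ n → KolyvaginHeegnerData Dt β ι m) (m : ℕ) (hm : m ∣ n)
      (τm : ringClassField K ι m ≃ₐ[ℚ] ringClassField K ι m),
      (∀ x : ringClassField K ι m, ((τm x : ringClassField K ι m) : ℂ) = starRingEnd ℂ x) →
      ∃ σ' ∈ ringClassGal ι m, IsOfFinAddOrder
        (pointGalHom W (ringClassField K ι m) τm (d m hm).y -
          (-W.rootNumber) • pointGalHom W (ringClassField K ι m) σ' (d m hm).y))
    (hGZ : ∀ [W.IsElliptic] (_hK : IsImaginaryQuadratic K) (_hH : SatisfiesHeegnerHypothesis N K)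
      (Dt : ModularParametrizationData W N) (β : ℤ) (ι : K →+* ℂ) {M : ℕ} (_hM : 1 ≤ M) {n : ℕ}
      (_hn : Squarefree n)
      (_hKol : ∀ q ∈ n.primeFactors, IsKolyvaginPrime N W K 3 q ∧ FrobEqFrobInfty W K (3 ^ M) q)
      (d : (m : ℕ) → m ∣ n → KolyvaginHeegnerData Dt β ι m),
      ∃ n' : ℤ, IsCoprime ((3 ^ M : ℕ) : ℤ) n' ∧
        ∀ (m : ℕ) (hm : m ∣ n) (γ : ringClassField K ι m ≃ₐ[ℚ] ringClassField K ι m),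
          γ ∈ ringClassGal ι m → ∀ v : HeightOneSpectrum (𝓞 K),
            ¬ (W.baseChange K).HasGoodReductionAt v →
            n' • pointsMap (W.baseChange K) (v.adicCompletion K)
                ((d m hm).toGeomPoints (pointGalHom W (ringClassField K ι m) γ (d m hm).y)) ∈
              E0Receptacle (W.baseChange K) v ∧
            ∀ (ℓ : ℕ) (hℓ : ℓ ∈ m.primeFactors)
              (hle : ringClassField K ι (m / ℓ) ≤ ringClassField K ι m),
              n' • pointsMap (W.baseChange K) (v.adicCompletion K)
                  ((d m hm).toGeomPoints (pointGalHom W (ringClassField K ι m) γ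
                    (WeierstrassCurve.Affine.Point.map (W' := W)
                      ((RingClassField.inclusion ι hle).restrictScalars ℚ)
                      (d (m / ℓ)
                        ((Nat.div_dvd_of_dvd (Nat.dvd_of_mem_primeFactors hℓ)).trans hm)).y))) ∈
                E0Receptacle (W.baseChange K) v)
    (hγ : ∀ [W.IsElliptic] (_hK : IsImaginaryQuadratic K) (_hH : SatisfiesHeegnerHypothesis N K)
      (Dt : ModularParametrizationData W N) (β : ℤ) (ι : K →+* ℂ) {M : ℕ}
      (_hM : 1 ≤ M) {n : ℕ} (_hn : Squarefree n)
      (_hKol : ∀ q ∈ n.primeFactors, IsKolyvaginPrime N W K 3 q ∧ FrobEqFrobInfty W K (3 ^ M) q)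
      (d : (m : ℕ) → m ∣ n → KolyvaginHeegnerData Dt β ι m)
      (m : ℕ) (hm : m ∣ n) (ℓ : ℕ) (hℓ : ℓ ∈ m.primeFactors) [Fact ℓ.Prime]
      (hΔ : ¬ (ℓ : ℤ) ∣ minimalDiscriminantInt W) (φ₀ : absoluteGaloisGroup (ZMod ℓ)),
      (∀ x : AlgebraicClosure (ZMod ℓ), φ₀ • x = x ^ ℓ) →
      ∀ (hle : ringClassField K ι (m / ℓ) ≤ ringClassField K ι m)
        (γ : ringClassField K ι m ≃ₐ[ℚ] ringClassField K ι m), γ ∈ ringClassGal ι m →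
        geomReduction hΔ ((RatClosure.pointsEquiv (K := K) W).symm
            ((d m hm).toGeomPoints (pointGalHom W (ringClassField K ι m) γ (d m hm).y))) =
          φ₀ • geomReduction hΔ ((RatClosure.pointsEquiv (K := K) W).symm
            ((d m hm).toGeomPoints (pointGalHom W (ringClassField K ι m) γ
              (WeierstrassCurve.Affine.Point.map (W' := W)
                ((RingClassField.inclusion ι hle).restrictScalars ℚ)
                (d (m / ℓ)
                  ((Nat.div_dvd_of_dvd (Nat.dvd_of_mem_primeFactors hℓ)).trans hm)).y))))) :
    ∀ [W.IsElliptic] (_hK : IsImaginaryQuadratic K) (_hH : SatisfiesHeegnerHypothesis N K)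
      {P : (W.baseChange K).toAffine.Point} (_hP : IsHeegnerPoint N W K P)
      (_hnt : ¬ IsOfFinAddOrder P) (_hρ : W.HasSurjectiveModNGaloisRep 3)
      {M₀ : ℕ} (_hM₀ : 1 ≤ M₀) [NeZero (3 ^ M₀)] {c : K ≃ₐ[ℚ] K} (_hc : c ≠ 1) (_hcc : c * c = 1)
      {x₀ : (W.baseChange K).toAffine.Point} (_hx₀ : 3 ^ M₀ • x₀ = P)
      (_hmax : ∀ Q : (W.baseChange K).toAffine.Point, 3 ^ (M₀ + 1) • Q ≠ P)
      (e : geomTorsion (W.baseChange K) ((3 ^ M₀ * 3 ^ M₀ : ℕ) : ℤ) →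
        geomTorsion (W.baseChange K) ((3 ^ M₀ * 3 ^ M₀ : ℕ) : ℤ) → AlgebraicClosure K)
      (hμ : ∀ S T, e S T ^ (3 ^ M₀ * 3 ^ M₀) = 1)
      (hadd₁ : ∀ S₁ S₂ T, e (S₁ + S₂) T = e S₁ T * e S₂ T)
      (hadd₂ : ∀ S T₁ T₂, e S (T₁ + T₂) = e S T₁ * e S T₂)
      (hgal : ∀ (σ : absoluteGaloisGroup K) (S T : geomTorsion (W.baseChange K) ((3 ^ M₀ * 3 ^ M₀ : ℕ) : ℤ)),
        σ • e S T = e (σ • S) (σ • T))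
      (halt : ∀ T, e T T = 1) (hnondeg : ∀ T, (∀ S, e S T = 1) → T = 0)
      (inv : LocalInvariants K (3 ^ M₀ * 3 ^ M₀)) (hPT' : inv.SumInvLocalizationEqZero)
      (hinv : ∀ v : HeightOneSpectrum (𝓞 K), Injective (inv (Sum.inr v)))
      (hH3 : ∀ x : galoisCohomology (mu K (3 ^ M₀ * 3 ^ M₀)) 3,
        (∀ v : Place K, galoisCohomology.localization (mu K (3 ^ M₀ * 3 ^ M₀)) v 3 x = 0) → x = 0)
      (hB : Literature.GroupTheory.FiniteAbelian.IsLevelPairing (3 ^ M₀)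
        (ctLevelPairing (W.baseChange K) (3 ^ M₀) e hμ hadd₁ hadd₂ hgal inv halt hPT' hH3
          (localTerm_finite_support (W := W.baseChange K) (m := 3 ^ M₀) (e := e) (hμ := hμ)
            (hadd₁ := hadd₁) (hadd₂ := hadd₂) (hgal := hgal) halt inv)))
      (hPτ : ∀ z ∈ selmerGroup (W.baseChange K) ((3 ^ M₀ * 3 ^ M₀ : ℕ) : ℤ),
        ∀ t ∈ selmerGroup (W.baseChange K) ((3 ^ M₀ * 3 ^ M₀ : ℕ) : ℤ),
        ctGeneralFun (W.baseChange K) (3 ^ M₀) e hμ hadd₁ hadd₂ hgal inv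
            (torsionH1ToH1 (W.baseChange K) _ (conjAct W c _ z))
            (torsionH1ToH1 (W.baseChange K) _ (conjAct W c _ t)) =
          ctGeneralFun (W.baseChange K) (3 ^ M₀) e hμ hadd₁ hadd₂ hgal inv
            (torsionH1ToH1 (W.baseChange K) _ z) (torsionH1ToH1 (W.baseChange K) _ t)),
      Finite (AddCommGroup.primaryComponent (W.baseChange K).sha 3) ∧
      (∀ c ∈ AddCommGroup.primaryComponent (W.baseChange K).sha 3, 3 ^ M₀ • c = 0) ∧
      Nat.card (AddCommGroup.primaryComponent (W.baseChange K).sha 3) ≤ 3 ^ (2 * M₀) ∧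
      padicValNat 3 (Nat.card (AddCommGroup.primaryComponent (W.baseChange K).sha 3)) ≤ 2 * M₀ := by
  intro _ hK hH P hP hnt hρ M₀ hM₀ _ c hc hcc x₀ hx₀ hmax e hμ hadd₁ hadd₂ hgal halt hnondeg inv hPT' hinv hH3 hB hPτ
  have h3 : 3 ∣ N := by
    rw [hN]
    exact (W.dvd_conductorNorm_iff_not_hasGoodReductionAtPrime 3).mpr
      (not_hasGoodReductionAtPrime_of_hasMultiplicativeReductionAtPrime 3 hmult)
  have hE : ¬ W.HasCM := fun hCM' ↦ W.not_hasMultiplicativeReductionAtPrime_of_hasCM hCM' 3 hmult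
  have hD := KolyvaginHexc.discr_ne_of_satisfiesHeegnerHypothesis_of_three_dvd hK.1 hH h3
  exact KolyvaginOrder.card_sha_primary_le_at_of_leafInputs_of_poitouTate_of_localDuality
    Nat.prime_three (by decide) hPT hN hrec hCM h53 hGZ hγ hE hK hD hH hP hnt hρ hM₀ hc hcc hx₀ hmax
    e hμ hadd₁ hadd₂ hgal halt hnondeg inv hPT' hinv hH3 hB hPτ

/-- **On the class X11b @ 3 ∩ (KN₃)/ℚ: `ord_3 #Ш(E/K)[3^∞] ≤ 2M₀` from FIVE cite-only inputs AT
`3` and the Cassels–Tate inputs — NO image hypothesis** (`ρ̄_{E,3}` onto by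
`surj_three_of_classX11b_of_kodairaNeron_rat`, `hGZ₃` by `KolyvaginHloc.hGZ_of_kodairaNeron_three_rat`),
for `3^{M₀} x₀ = y_K ∉ 3^{M₀+1}E(K)`, `M₀ ≥ 1`.  Binders = those of
`Three.KolyvaginAnnihilator.pow_smul_sha_three_primary_eq_zero_of_classX11b_of_kodairaNeron_rat'`
VERBATIM.  CONDITIONAL on EXACTLY {`hPT`, `hrec`, `hCM`, `h53`, `hγ`} at `3` + `hN` + (KN₃)/ℚ +
the displayed Cassels–Tate inputs; cite-only, NOT discharged; nothing booked; no mark.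
[cite: McCallumLMS1991, §1 Theorem (Kolyvagin), Lemma 5.1, Cor. 5.6] [cite: GrossLMS1991, Thm. 2.2 (2), §10]
[cite: Serre1972, §2.4 Prop. 15] [cite: SilvermanAEC2009, Thm. VII.6.1] -/
theorem card_sha_three_primary_le_of_classX11b_of_kodairaNeron_rat_of_localDuality' [NeZero N]
    [W.IsGloballyMinimal] (hW : ClassX11b W 3)
    (hPT : Literature.NumberTheory.GaloisCohomology.poitouTate_sum_localTatePairing_eq_zero K)
    (hN : ∀ [W.IsElliptic], N = W.conductorNorm ℤ)
    (hrec : heegnerPointOfConductor_one_galoisConj N W K)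
    (hCM : ∀ [W.IsElliptic] (_hK : IsImaginaryQuadratic K) (_hH : SatisfiesHeegnerHypothesis N K)
      (Dt : ModularParametrizationData W N) (β : ℤ) (ι : K →+* ℂ),
      (4 * N : ℤ) ∣ β ^ 2 - NumberField.discr K →
      ∀ {M : ℕ}, 1 ≤ M → ∀ (m : ℕ), Squarefree m →
      (∀ q ∈ m.primeFactors, IsKolyvaginPrime N W K 3 q ∧ FrobEqFrobInfty W K (3 ^ M) q) →
      ∃ y : (W.baseChange (ringClassField K ι m)).toAffine.Point,
        WeierstrassCurve.Affine.Point.map (W' := W) (ringClassField K ι m).subtype.toRatAlgHom y =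
          heegnerPointComplexOfConductor Dt (NumberField.discr K) β m)
    (h53 : ∀ [W.IsElliptic] (_hK : IsImaginaryQuadratic K) (_hH : SatisfiesHeegnerHypothesis N K)
      (Dt : ModularParametrizationData W N) (β : ℤ) (ι : K →+* ℂ) {M : ℕ}
      (_hM : 1 ≤ M) {n : ℕ} (_hn : Squarefree n)
      (_hKol : ∀ q ∈ n.primeFactors, IsKolyvaginPrime N W K 3 q ∧ FrobEqFrobInfty W K (3 ^ M) q)
      (d : (m : ℕ) → m ∣ n → KolyvaginHeegnerData Dt β ι m) (m : ℕ) (hm : m ∣ n)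
      (τm : ringClassField K ι m ≃ₐ[ℚ] ringClassField K ι m),
      (∀ x : ringClassField K ι m, ((τm x : ringClassField K ι m) : ℂ) = starRingEnd ℂ x) →
      ∃ σ' ∈ ringClassGal ι m, IsOfFinAddOrder
        (pointGalHom W (ringClassField K ι m) τm (d m hm).y -
          (-W.rootNumber) • pointGalHom W (ringClassField K ι m) σ' (d m hm).y))
    (hKN3m : ∀ [W.IsElliptic] (v : HeightOneSpectrum (𝓞 ℚ)),
      W.HasMultiplicativeReductionAt v → ¬ 3 ∣ W.ordMinimalDiscriminant v)
    (hKN3a : ∀ [W.IsElliptic] (v : HeightOneSpectrum (𝓞 ℚ)), W.HasAdditiveReductionAt v →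
      W.kodairaSymbolAt v ≠ KodairaSymbol.IV ∧ W.kodairaSymbolAt v ≠ KodairaSymbol.IVstar)
    (hγ : ∀ [W.IsElliptic] (_hK : IsImaginaryQuadratic K) (_hH : SatisfiesHeegnerHypothesis N K)
      (Dt : ModularParametrizationData W N) (β : ℤ) (ι : K →+* ℂ) {M : ℕ}
      (_hM : 1 ≤ M) {n : ℕ} (_hn : Squarefree n)
      (_hKol : ∀ q ∈ n.primeFactors, IsKolyvaginPrime N W K 3 q ∧ FrobEqFrobInfty W K (3 ^ M) q)
      (d : (m : ℕ) → m ∣ n → KolyvaginHeegnerData Dt β ι m)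
      (m : ℕ) (hm : m ∣ n) (ℓ : ℕ) (hℓ : ℓ ∈ m.primeFactors) [Fact ℓ.Prime]
      (hΔ : ¬ (ℓ : ℤ) ∣ minimalDiscriminantInt W) (φ₀ : absoluteGaloisGroup (ZMod ℓ)),
      (∀ x : AlgebraicClosure (ZMod ℓ), φ₀ • x = x ^ ℓ) →
      ∀ (hle : ringClassField K ι (m / ℓ) ≤ ringClassField K ι m)
        (γ : ringClassField K ι m ≃ₐ[ℚ] ringClassField K ι m), γ ∈ ringClassGal ι m →
        geomReduction hΔ ((RatClosure.pointsEquiv (K := K) W).symm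
            ((d m hm).toGeomPoints (pointGalHom W (ringClassField K ι m) γ (d m hm).y))) =
          φ₀ • geomReduction hΔ ((RatClosure.pointsEquiv (K := K) W).symm
            ((d m hm).toGeomPoints (pointGalHom W (ringClassField K ι m) γ
              (WeierstrassCurve.Affine.Point.map (W' := W)
                ((RingClassField.inclusion ι hle).restrictScalars ℚ)
                (d (m / ℓ)
                  ((Nat.div_dvd_of_dvd (Nat.dvd_of_mem_primeFactors hℓ)).trans hm)).y))))) :
    ∀ [W.IsElliptic] (_hK : IsImaginaryQuadratic K) (_hH : SatisfiesHeegnerHypothesis N K)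
      {P : (W.baseChange K).toAffine.Point} (_hP : IsHeegnerPoint N W K P)
      (_hnt : ¬ IsOfFinAddOrder P)
      {M₀ : ℕ} (_hM₀ : 1 ≤ M₀) [NeZero (3 ^ M₀)] {c : K ≃ₐ[ℚ] K} (_hc : c ≠ 1) (_hcc : c * c = 1)
      {x₀ : (W.baseChange K).toAffine.Point} (_hx₀ : 3 ^ M₀ • x₀ = P)
      (_hmax : ∀ Q : (W.baseChange K).toAffine.Point, 3 ^ (M₀ + 1) • Q ≠ P)
      (e : geomTorsion (W.baseChange K) ((3 ^ M₀ * 3 ^ M₀ : ℕ) : ℤ) →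
        geomTorsion (W.baseChange K) ((3 ^ M₀ * 3 ^ M₀ : ℕ) : ℤ) → AlgebraicClosure K)
      (hμ : ∀ S T, e S T ^ (3 ^ M₀ * 3 ^ M₀) = 1)
      (hadd₁ : ∀ S₁ S₂ T, e (S₁ + S₂) T = e S₁ T * e S₂ T)
      (hadd₂ : ∀ S T₁ T₂, e S (T₁ + T₂) = e S T₁ * e S T₂)
      (hgal : ∀ (σ : absoluteGaloisGroup K) (S T : geomTorsion (W.baseChange K) ((3 ^ M₀ * 3 ^ M₀ : ℕ) : ℤ)),
        σ • e S T = e (σ • S) (σ • T))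
      (halt : ∀ T, e T T = 1) (hnondeg : ∀ T, (∀ S, e S T = 1) → T = 0)
      (inv : LocalInvariants K (3 ^ M₀ * 3 ^ M₀)) (hPT' : inv.SumInvLocalizationEqZero)
      (hinv : ∀ v : HeightOneSpectrum (𝓞 K), Injective (inv (Sum.inr v)))
      (hH3 : ∀ x : galoisCohomology (mu K (3 ^ M₀ * 3 ^ M₀)) 3,
        (∀ v : Place K, galoisCohomology.localization (mu K (3 ^ M₀ * 3 ^ M₀)) v 3 x = 0) → x = 0)
      (hB : Literature.GroupTheory.FiniteAbelian.IsLevelPairing (3 ^ M₀)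
        (ctLevelPairing (W.baseChange K) (3 ^ M₀) e hμ hadd₁ hadd₂ hgal inv halt hPT' hH3
          (localTerm_finite_support (W := W.baseChange K) (m := 3 ^ M₀) (e := e) (hμ := hμ)
            (hadd₁ := hadd₁) (hadd₂ := hadd₂) (hgal := hgal) halt inv)))
      (hPτ : ∀ z ∈ selmerGroup (W.baseChange K) ((3 ^ M₀ * 3 ^ M₀ : ℕ) : ℤ),
        ∀ t ∈ selmerGroup (W.baseChange K) ((3 ^ M₀ * 3 ^ M₀ : ℕ) : ℤ),
        ctGeneralFun (W.baseChange K) (3 ^ M₀) e hμ hadd₁ hadd₂ hgal inv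
            (torsionH1ToH1 (W.baseChange K) _ (conjAct W c _ z))
            (torsionH1ToH1 (W.baseChange K) _ (conjAct W c _ t)) =
          ctGeneralFun (W.baseChange K) (3 ^ M₀) e hμ hadd₁ hadd₂ hgal inv
            (torsionH1ToH1 (W.baseChange K) _ z) (torsionH1ToH1 (W.baseChange K) _ t)),
      Finite (AddCommGroup.primaryComponent (W.baseChange K).sha 3) ∧
      (∀ c ∈ AddCommGroup.primaryComponent (W.baseChange K).sha 3, 3 ^ M₀ • c = 0) ∧
      Nat.card (AddCommGroup.primaryComponent (W.baseChange K).sha 3) ≤ 3 ^ (2 * M₀) ∧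
      padicValNat 3 (Nat.card (AddCommGroup.primaryComponent (W.baseChange K).sha 3)) ≤ 2 * M₀ := by
  intro _ hK hH P hP hnt M₀ hM₀ _ c hc hcc x₀ hx₀ hmax e hμ hadd₁ hadd₂ hgal halt hnondeg inv hPT' hinv hH3 hB hPτ
  exact card_sha_three_primary_le_of_leafInputs_of_poitouTate_of_localDuality hPT hN hW.2.2.1 hrec
    hCM h53
    (@fun _ hK hH Dt _ ι _ _ _ hn hKol d ↦
      KolyvaginHloc.hGZ_of_kodairaNeron_three_rat hK hH ι Dt hn hKol d hKN3m hKN3a) hγ hK hH hP hnt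
    (surj_three_of_classX11b_of_kodairaNeron_rat hW hKN3m) hM₀ hc hcc hx₀ hmax
    e hμ hadd₁ hadd₂ hgal halt hnondeg inv hPT' hinv hH3 hB hPτ

/-- **McCallum 1991 §1 Theorem (Kolyvagin) at `p = 3` on the class X11b @ 3 ∩ (KN₃)/ℚ, in the
printed Heegner-INDEX form: `ord_3 #Ш(E/K)[3^∞] ≤ 2 · ord_3 [E(K) : ℤ y_K]`** (for `[E(K) : ℤ y_K]`
finite, `_hidx`; the index is Mathlib's `AddSubgroup.index`), together with: `Ш(E/K)[3^∞]` finite,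
killed by `3^{M₀}`, of order `≤ 3^{2M₀}`, `M₀ = ord_3 [E(K) : ℤ y_K]`.  McCallum's Lemma 5.1
(`M₀ = max{M : y_K ∈ 3^M E(K)}`, tree `Additive.zsmul_certificate_of_padicValNat_index`, using
`E(K)[3] = 0`) converts the index into `3^{M₀} x₀ = y_K ∉ 3^{M₀+1}E(K)`; `M₀ ≥ 1` is the previous
theorem, `M₀ = 0` is `Ш(E/K)[3^∞] = 0` (Gross Prop. 2.1 (2), the tree's
`sha_three_primary_eq_zero_of_classX11b_of_kodairaNeron_rat_of_not_dvd`).  This is the `hB` binder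
(`Kolyvagin1990_padicValNat_card_sha_le`) of `bsdp_of_classX11b_three_of_onTreeInputs` at the prime `3`
for the `3`-primary part, MODULO the FIVE labels + `hN` + (KN₃)/ℚ + the Cassels–Tate inputs —
NOT the fact; nothing booked. [cite: McCallumLMS1991, §1 Theorem (Kolyvagin), Lemma 5.1 (p. 303), Cor. 5.6]
[cite: GrossLMS1991, §2 Prop. 2.1 (2), Thm. 2.2 (2)] [cite: MilneADT2006, Ch. I §6, Thm. 6.13(a)] -/
theorem card_sha_three_primary_le_of_classX11b_of_kodairaNeron_rat_index_of_localDuality [NeZero N]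
    [W.IsGloballyMinimal] (hW : ClassX11b W 3)
    (hPT : Literature.NumberTheory.GaloisCohomology.poitouTate_sum_localTatePairing_eq_zero K)
    (hN : ∀ [W.IsElliptic], N = W.conductorNorm ℤ)
    (hrec : heegnerPointOfConductor_one_galoisConj N W K)
    (hCM : ∀ [W.IsElliptic] (_hK : IsImaginaryQuadratic K) (_hH : SatisfiesHeegnerHypothesis N K)
      (Dt : ModularParametrizationData W N) (β : ℤ) (ι : K →+* ℂ),
      (4 * N : ℤ) ∣ β ^ 2 - NumberField.discr K →
      ∀ {M : ℕ}, 1 ≤ M → ∀ (m : ℕ), Squarefree m →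
      (∀ q ∈ m.primeFactors, IsKolyvaginPrime N W K 3 q ∧ FrobEqFrobInfty W K (3 ^ M) q) →
      ∃ y : (W.baseChange (ringClassField K ι m)).toAffine.Point,
        WeierstrassCurve.Affine.Point.map (W' := W) (ringClassField K ι m).subtype.toRatAlgHom y =
          heegnerPointComplexOfConductor Dt (NumberField.discr K) β m)
    (h53 : ∀ [W.IsElliptic] (_hK : IsImaginaryQuadratic K) (_hH : SatisfiesHeegnerHypothesis N K)
      (Dt : ModularParametrizationData W N) (β : ℤ) (ι : K →+* ℂ) {M : ℕ}
      (_hM : 1 ≤ M) {n : ℕ} (_hn : Squarefree n)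
      (_hKol : ∀ q ∈ n.primeFactors, IsKolyvaginPrime N W K 3 q ∧ FrobEqFrobInfty W K (3 ^ M) q)
      (d : (m : ℕ) → m ∣ n → KolyvaginHeegnerData Dt β ι m) (m : ℕ) (hm : m ∣ n)
      (τm : ringClassField K ι m ≃ₐ[ℚ] ringClassField K ι m),
      (∀ x : ringClassField K ι m, ((τm x : ringClassField K ι m) : ℂ) = starRingEnd ℂ x) →
      ∃ σ' ∈ ringClassGal ι m, IsOfFinAddOrder
        (pointGalHom W (ringClassField K ι m) τm (d m hm).y -
          (-W.rootNumber) • pointGalHom W (ringClassField K ι m) σ' (d m hm).y))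
    (hKN3m : ∀ [W.IsElliptic] (v : HeightOneSpectrum (𝓞 ℚ)),
      W.HasMultiplicativeReductionAt v → ¬ 3 ∣ W.ordMinimalDiscriminant v)
    (hKN3a : ∀ [W.IsElliptic] (v : HeightOneSpectrum (𝓞 ℚ)), W.HasAdditiveReductionAt v →
      W.kodairaSymbolAt v ≠ KodairaSymbol.IV ∧ W.kodairaSymbolAt v ≠ KodairaSymbol.IVstar)
    (hγ : ∀ [W.IsElliptic] (_hK : IsImaginaryQuadratic K) (_hH : SatisfiesHeegnerHypothesis N K)
      (Dt : ModularParametrizationData W N) (β : ℤ) (ι : K →+* ℂ) {M : ℕ}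
      (_hM : 1 ≤ M) {n : ℕ} (_hn : Squarefree n)
      (_hKol : ∀ q ∈ n.primeFactors, IsKolyvaginPrime N W K 3 q ∧ FrobEqFrobInfty W K (3 ^ M) q)
      (d : (m : ℕ) → m ∣ n → KolyvaginHeegnerData Dt β ι m)
      (m : ℕ) (hm : m ∣ n) (ℓ : ℕ) (hℓ : ℓ ∈ m.primeFactors) [Fact ℓ.Prime]
      (hΔ : ¬ (ℓ : ℤ) ∣ minimalDiscriminantInt W) (φ₀ : absoluteGaloisGroup (ZMod ℓ)),
      (∀ x : AlgebraicClosure (ZMod ℓ), φ₀ • x = x ^ ℓ) →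
      ∀ (hle : ringClassField K ι (m / ℓ) ≤ ringClassField K ι m)
        (γ : ringClassField K ι m ≃ₐ[ℚ] ringClassField K ι m), γ ∈ ringClassGal ι m →
        geomReduction hΔ ((RatClosure.pointsEquiv (K := K) W).symm
            ((d m hm).toGeomPoints (pointGalHom W (ringClassField K ι m) γ (d m hm).y))) =
          φ₀ • geomReduction hΔ ((RatClosure.pointsEquiv (K := K) W).symm
            ((d m hm).toGeomPoints (pointGalHom W (ringClassField K ι m) γ
              (WeierstrassCurve.Affine.Point.map (W' := W)
                ((RingClassField.inclusion ι hle).restrictScalars ℚ)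
                (d (m / ℓ)
                  ((Nat.div_dvd_of_dvd (Nat.dvd_of_mem_primeFactors hℓ)).trans hm)).y))))) :
    ∀ [W.IsElliptic] (_hK : IsImaginaryQuadratic K) (_hH : SatisfiesHeegnerHypothesis N K)
      {P : (W.baseChange K).toAffine.Point} (_hP : IsHeegnerPoint N W K P)
      (_hnt : ¬ IsOfFinAddOrder P) (_hidx : (AddSubgroup.zmultiples P).index ≠ 0)
      {M₀ : ℕ} (_hv : padicValNat 3 (AddSubgroup.zmultiples P).index = M₀) [NeZero (3 ^ M₀)]
      {c : K ≃ₐ[ℚ] K} (_hc : c ≠ 1) (_hcc : c * c = 1)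
      (e : geomTorsion (W.baseChange K) ((3 ^ M₀ * 3 ^ M₀ : ℕ) : ℤ) →
        geomTorsion (W.baseChange K) ((3 ^ M₀ * 3 ^ M₀ : ℕ) : ℤ) → AlgebraicClosure K)
      (hμ : ∀ S T, e S T ^ (3 ^ M₀ * 3 ^ M₀) = 1)
      (hadd₁ : ∀ S₁ S₂ T, e (S₁ + S₂) T = e S₁ T * e S₂ T)
      (hadd₂ : ∀ S T₁ T₂, e S (T₁ + T₂) = e S T₁ * e S T₂)
      (hgal : ∀ (σ : absoluteGaloisGroup K) (S T : geomTorsion (W.baseChange K) ((3 ^ M₀ * 3 ^ M₀ : ℕ) : ℤ)),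
        σ • e S T = e (σ • S) (σ • T))
      (halt : ∀ T, e T T = 1) (hnondeg : ∀ T, (∀ S, e S T = 1) → T = 0)
      (inv : LocalInvariants K (3 ^ M₀ * 3 ^ M₀)) (hPT' : inv.SumInvLocalizationEqZero)
      (hinv : ∀ v : HeightOneSpectrum (𝓞 K), Injective (inv (Sum.inr v)))
      (hH3 : ∀ x : galoisCohomology (mu K (3 ^ M₀ * 3 ^ M₀)) 3,
        (∀ v : Place K, galoisCohomology.localization (mu K (3 ^ M₀ * 3 ^ M₀)) v 3 x = 0) → x = 0)
      (hB : Literature.GroupTheory.FiniteAbelian.IsLevelPairing (3 ^ M₀)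
        (ctLevelPairing (W.baseChange K) (3 ^ M₀) e hμ hadd₁ hadd₂ hgal inv halt hPT' hH3
          (localTerm_finite_support (W := W.baseChange K) (m := 3 ^ M₀) (e := e) (hμ := hμ)
            (hadd₁ := hadd₁) (hadd₂ := hadd₂) (hgal := hgal) halt inv)))
      (hPτ : ∀ z ∈ selmerGroup (W.baseChange K) ((3 ^ M₀ * 3 ^ M₀ : ℕ) : ℤ),
        ∀ t ∈ selmerGroup (W.baseChange K) ((3 ^ M₀ * 3 ^ M₀ : ℕ) : ℤ),
        ctGeneralFun (W.baseChange K) (3 ^ M₀) e hμ hadd₁ hadd₂ hgal inv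
            (torsionH1ToH1 (W.baseChange K) _ (conjAct W c _ z))
            (torsionH1ToH1 (W.baseChange K) _ (conjAct W c _ t)) =
          ctGeneralFun (W.baseChange K) (3 ^ M₀) e hμ hadd₁ hadd₂ hgal inv
            (torsionH1ToH1 (W.baseChange K) _ z) (torsionH1ToH1 (W.baseChange K) _ t)),
      Finite (AddCommGroup.primaryComponent (W.baseChange K).sha 3) ∧
      (∀ c ∈ AddCommGroup.primaryComponent (W.baseChange K).sha 3, 3 ^ M₀ • c = 0) ∧
      Nat.card (AddCommGroup.primaryComponent (W.baseChange K).sha 3) ≤ 3 ^ (2 * M₀) ∧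
      padicValNat 3 (Nat.card (AddCommGroup.primaryComponent (W.baseChange K).sha 3)) ≤ 2 * M₀ := by
  intro _ hK hH P hP hnt hidx M₀ hv _ c hc hcc e hμ hadd₁ hadd₂ hgal halt hnondeg inv hPT' hinv hH3 hB hPτ
  haveI : (W.baseChange K).IsElliptic := inferInstanceAs (W.map (algebraMap ℚ K)).IsElliptic
  have hρ := surj_three_of_classX11b_of_kodairaNeron_rat hW hKN3m
  -- `E(K)[3] = 0`
  have hbot := torsionBy_eq_bot_of_isImaginaryQuadratic W K hK Nat.prime_three (by decide) hρ
  have hA : ∀ a : (W.baseChange K).toAffine.Point, ((3 : ℕ) : ℤ) • a = 0 → a = 0 := fun a ha ↦ by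
    have : a ∈ AddSubgroup.torsionBy (W.baseChange K).toAffine.Point ((3 : ℕ) : ℤ) := by
      rw [mem_torsionBy_iff]; exact ha
    rw [hbot] at this
    exact this
  -- McCallum Lemma 5.1: `ord_3 [E(K) : ℤ y_K] = M₀ ⟺ 3^{M₀} ∥ y_K`
  obtain ⟨⟨x₀, hx₀⟩, hmax'⟩ :=
    Additive.zsmul_certificate_of_padicValNat_index Nat.prime_three hA hnt hidx hv
  have hx₀' : 3 ^ M₀ • x₀ = P := by rw [← natCast_zsmul]; exact hx₀
  have hmax : ∀ Q : (W.baseChange K).toAffine.Point, 3 ^ (M₀ + 1) • Q ≠ P := fun Q hQ ↦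
    hmax' ⟨Q, by rw [natCast_zsmul]; exact hQ⟩
  rcases Nat.eq_zero_or_pos M₀ with h0 | hpos
  · -- `3 ∤ y_K`: `Ш(E/K)[3^∞] = 0` (Gross Prop. 2.1 (2); the tree's `…_of_not_dvd`)
    subst h0
    have hzero := sha_three_primary_eq_zero_of_classX11b_of_kodairaNeron_rat_of_not_dvd hW hPT hN
      hrec hCM h53 hKN3m hKN3a hγ hK hH hP hnt (fun Q ↦ by simpa using hmax Q)
    have hz : ∀ c ∈ AddCommGroup.primaryComponent (W.baseChange K).sha 3, c = 0 := fun c hc ↦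
      hzero c (AddCommGroup.mem_primaryComponent.mp hc)
    haveI : Subsingleton (AddCommGroup.primaryComponent (W.baseChange K).sha 3) :=
      ⟨fun a b ↦ Subtype.ext ((hz a.1 a.2).trans (hz b.1 b.2).symm)⟩
    have hcard : Nat.card (AddCommGroup.primaryComponent (W.baseChange K).sha 3) = 1 :=
      Nat.card_eq_one_iff_unique.mpr ⟨inferInstance, ⟨0⟩⟩
    refine ⟨Finite.of_subsingleton, fun c hc ↦ ?_, by rw [hcard]; simp, by rw [hcard]; simp⟩
    rw [hz c hc, smul_zero]
  · exact card_sha_three_primary_le_of_classX11b_of_kodairaNeron_rat_of_localDuality' hW hPT hN hrec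
      hCM h53 hKN3m hKN3a hγ hK hH hP hnt hpos hc hcc hx₀' hmax e hμ hadd₁ hadd₂ hgal halt hnondeg inv hPT' hinv hH3 hB hPτ

end Summit.BirchSwinnertonDyer.Rank1Residual.X11b.Three.KolyvaginOrder

end
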